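import Summits.HubbardSuperconductivity.HubbardSuperconductivity.Theorems.BirGappedPhaseReductionR.Negative.XYPairTable

/-!
# Crux `BirGappedPhaseReductionR` (item `stmt-HubbardSuperconductivity-14846`): the engine's threshold `K₀` is NOT uniform in the coercivity constant

Negative-side lemma of the standing disprover of crux 4R of route BalabanIR
(`BirGappedPhaseReductionR := BirComplexStableXYR → BirBdGPhaseCoercivity → BirGroundStateAverageLRO`,
the constructive-fermion reduction feeding the restated engine, crux 2R, with the static BdG phase
coercivity, crux 3).  NOTHING HERE ASSERTS A `Theses` DECL AND NO DEFINITION IS INTRODUCED: the mutated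
statement is spelled out inside `not_birComplexStableXYR_uniformThreshold`, whose type is

  `¬ (∀ r B, 2 ≤ r → ∃ K₀ L₀, ∀ c₀ > 0, ∀ K ≥ K₀, ∀ c, (U1) → (N) → (A ≤ B) → (C c₀) → (R) → (P) → ∀ even L₀ ≤ L ≤ M, Z ≠ 0 ∧ 1/2 ≤ Re(N/Z))`

— the text of `Theses.BalabanIR.BirComplexStableXYR` VERBATIM except that the threshold `∃ K₀ L₀` is chosen
BEFORE the coercivity constant `∀ c₀ > 0` (`K₀ = K₀(r, B)` uniform in `c₀`).

Mechanism (sorry-free, elementary): the all-pairs REAL XY window table `xyPair[r, a]` of file `…XYPairTable`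
is admissible for EVERY `a ∈ (0,1]` with budget `B = a r⁶(1+e²) ≤ 64(1+e²)` (`r = 2`), coercivity constant
`c₀ = a` (equality in (C)), and satisfies (R), (P).  Its action is `(K a) · S(θ)` for ONE functional `S`
(`action_xyPair`), so the engine sees only the product `κ = K a`; at fixed `(L, M)` the slice order `Re(N_κ/Z_κ)`
is continuous in `κ` (parametric integrals of a jointly continuous integrand over the compact cube,
`continuous_couplingIntegral`) and equals `1/L² < 1/2` at `κ = 0` (`sliceRatio_zero_lt_half`: Fubini +
`∫₀^{2π} e^{it} dt = 0`).  Given a putative uniform `K₀`: `K = max K₀ 1`, `L = M = 2L₀ + 2`, `a = κ₁/K` with the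
small `κ₁ ≤ 1` of `exists_small_coupling` — contradiction.

READING FOR CRUX 4R (why this is filed under `BirGappedPhaseReductionR/Negative`).  By the same scaling the honest
threshold of crux 2R has the form `K₀(r,B,c₀) = k₀(r, B/c₀)/c₀ ≥ κ_*(L₀)/c₀`: it DIVERGES as `c₀ ↓ 0`.  The
reduction's dictionary takes its coercivity constant from crux 3 AS TYPED — a GLOBAL inequality on the
MICROSCOPIC lattice whose constant obeys `c₀ ≤ |Δ₁| + |Δ₂|` (`Theorems.BirBdG.birBdG_constant_le`) and in truth
`≤ κ/4 ~ Δ² log(1/Δ)` (`Theorems.BirBdG.ceiling_of_coercive`, staggered texture) — through the slice weight bound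
`‖Tr ∏_τ e^{-aH(θ_τ)}‖ ≤ 4^{L²} e^{-(a c₀/2) Σ_τ S_τ} Tr e^{-MaH(0)}` (`Theorems.norm_trace_prod_gibbs_bdg_le_of_coercive`).
Per block bond (side `ξ = v_F/Δ`, Trotter step `a = 1/Δ`) and unit stiffness `K ~ E_F/Δ` this is an engine constant
`c₀^eng ~ a c₀ ξ / K ~ Δ log(1/Δ) → 0` as `U ↓ 0`, while the analyticity budget `B^eng` stays `O(1)`.  The typed
engine offers only `∃ K₀(r, B, c₀)` with UNKNOWN dependence, and the only mechanism making `K` large is `U ↓ 0`,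
so a proof of 4R through the typed 2R needs `(B^eng, c₀^eng)` admissible UNIFORMLY as `U ↓ 0` — which the
condensation-scale constant of crux 3 does not give: either crux 3 is consumed at BLOCK level (coercivity of the
order of the stiffness; the planner's recorded caveat "crux 3 RESTATED, antecedent swapped"), or 2R is consumed
with an explicit rate.  This theorem is the kernel-checked half of that bookkeeping: uniformity of `K₀` in `c₀`
fails already on the real XY face of the class.

Standing disprover refuter-cdisprove-stmt-HubbardSuperconductivity-14846-0, 2026-08-16; work file with the full
attack log: `Cruxes/BirGappedPhaseReductionR/Disproof.lean`.  The zero-coupling slice integral is adapted from the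
rev-0 work file `Cruxes/BirGappedPhaseReduction/Disproof.lean` §3 (cdisprove on stmt-2082).  References:
J. Fröhlich, B. Simon, T. Spencer, Comm. Math. Phys. 50 (1976) 79 (XY slice order at small coupling is free-field
like; only the trivial point `κ = 0` and continuity are used here). [folklore]
-/

noncomputable section

namespace Summit.HubbardSuperconductivity.HubbardSuperconductivity.Theorems.BirGappedPhaseReductionR.Negative

open scoped BigOperators ComplexConjugate
open MeasureTheory Complex Set Literature.Probability.LatticeModels
open Summit.HubbardSuperconductivity.BirComplexStableXYNegative

variable {r : ℕ}

/-! ### §1 The action of the table sees only the product `K · a` -/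

/-- `A_{K, xyPair a}(θ) = (K a) · S(θ)`, `S(θ) = Σ_s Σ_{(w,w')} (1 − e^{i(θ_{s+w} − θ_{s+w'})})`. [folklore] -/
theorem action_xyPair (K a : ℝ) (L M : ℕ) [NeZero L] [NeZero M] (θ : Λ L M → ℝ) :
    action K ((∑ p : W r × W r, ((a : ℝ) : ℂ) • (Finsupp.single (0 : Freq r) (1 : ℂ) -
      Finsupp.single (Pi.single (Prod.fst p) (1 : ℤ) - Pi.single (Prod.snd p) (1 : ℤ)) (1 : ℂ)) : Table r)) L M θ = ((K * a : ℝ) : ℂ) *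
      ∑ s : Λ L M, ∑ p : W r × W r,
        (1 - cexp (I * ((θ (sh L M s p.1) - θ (sh L M s p.2) : ℝ) : ℂ))) := by
  unfold action
  simp_rw [genF_xyPair]
  rw [← Finset.mul_sum, ← mul_assoc, Complex.ofReal_mul]

/-! ### §2 Continuity in the coupling; the value at zero coupling -/

/-- `κ ↦ ∫_cube g e^{−κ S}` is continuous for continuous `S`, `g` (parametric integral of a jointly
continuous integrand over the compact cube). [folklore] -/
theorem continuous_couplingIntegral (L M : ℕ) [NeZero L] [NeZero M] {S g : (Λ L M → ℝ) → ℂ}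
    (hS : Continuous S) (hg : Continuous g) :
    Continuous fun κ : ℝ => ∫ θ in cube L M, g θ * cexp (-((κ : ℂ) * S θ)) := by
  have h : Continuous (Function.uncurry fun (κ : ℝ) (θ : Λ L M → ℝ) =>
      g θ * cexp (-((κ : ℂ) * S θ))) := by
    show Continuous fun p : ℝ × (Λ L M → ℝ) => g p.2 * cexp (-((p.1 : ℂ) * S p.2))
    fun_prop
  have hc : IsCompact (cube L M) := isCompact_univ_pi fun _ => isCompact_Icc
  exact continuous_parametric_integral_of_continuous h hc

/-- `∫_{[0,2π]} e^{it} dt = 0`. [folklore] -/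
theorem setIntegral_Icc_cexp_I_mul :
    ∫ t in Icc (0:ℝ) (2 * Real.pi), cexp (I * (t : ℂ)) = 0 := by
  rw [integral_Icc_eq_integral_Ioc, ← intervalIntegral.integral_of_le (by positivity),
    integral_exp_mul_complex I_ne_zero]
  have h2 : cexp (I * (2 * (Real.pi : ℂ))) = 1 := by
    rw [show I * (2 * (Real.pi : ℂ)) = 2 * Real.pi * I by ring]
    exact exp_two_pi_mul_I
  push_cast
  simp [h2]

/-- `∫_{[0,2π]} 1 dt = 2π` (complex-valued). [folklore] -/
theorem setIntegral_Icc_one :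
    ∫ _t in Icc (0:ℝ) (2 * Real.pi), (1 : ℂ) = ((2 * Real.pi : ℝ) : ℂ) := by
  rw [setIntegral_const, Real.volume_real_Icc_of_le (by positivity), sub_zero, Complex.real_smul, mul_one]

/-- orthogonality on the cube `[0,2π]^Λ`: `∫ e^{iθ_a} e^{-iθ_b} dθ = [a = b] (2π)^{|Λ|}`. [folklore] -/
theorem integral_cube_cexp_mul_cexp_neg {Λ' : Type*} [Fintype Λ'] [DecidableEq Λ'] (a b : Λ') :
    ∫ θ in Set.pi Set.univ (fun _ : Λ' => Icc (0:ℝ) (2 * Real.pi)),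
      cexp (I * (θ a : ℂ)) * cexp (-(I * (θ b : ℂ))) =
    if a = b then (((2 * Real.pi) ^ Fintype.card Λ' : ℝ) : ℂ) else 0 := by
  rw [volume_pi, Measure.restrict_pi_pi]
  set f : Λ' → ℝ → ℂ := fun i t =>
    (if i = a then cexp (I * (t : ℂ)) else 1) * (if i = b then cexp (-(I * (t : ℂ))) else 1) with hf
  have hprod : ∀ θ : Λ' → ℝ, (∏ i, f i (θ i)) = cexp (I * (θ a : ℂ)) * cexp (-(I * (θ b : ℂ))) := by
    intro θ
    simp only [hf, Finset.prod_mul_distrib, Finset.prod_ite_eq', Finset.mem_univ, if_true]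
  simp_rw [← hprod]
  rw [integral_fintype_prod_eq_prod]
  by_cases hab : a = b
  · subst hab
    have hfi : ∀ i, (∫ t in Icc (0:ℝ) (2 * Real.pi), f i t) = ((2 * Real.pi : ℝ) : ℂ) := by
      intro i
      by_cases hi : i = a
      · subst hi
        have : ∀ t : ℝ, f i t = 1 := fun t => by
          simp only [hf, if_true, ← Complex.exp_add, add_neg_cancel, Complex.exp_zero]
        simp_rw [this]; exact setIntegral_Icc_one
      · have : ∀ t : ℝ, f i t = 1 := fun t => by simp [hf, hi]
        simp_rw [this]; exact setIntegral_Icc_one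
    simp_rw [hfi]
    simp [Finset.prod_const, Finset.card_univ]
  · rw [if_neg hab]
    apply Finset.prod_eq_zero (Finset.mem_univ a)
    have : ∀ t : ℝ, f a t = cexp (I * (t : ℂ)) := fun t => by simp [hf, hab]
    simp_rw [this]
    exact setIntegral_Icc_cexp_I_mul

/-- `|Σ_x e^{iθ_x}|²` as a double sum. [folklore] -/
theorem normSq_sum_cexp {σ : Type*} [Fintype σ] (θ : σ → ℝ) :
    (((‖∑ x, cexp (I * (θ x : ℂ))‖ ^ 2 : ℝ)) : ℂ) =
      ∑ x, ∑ y, cexp (I * (θ x : ℂ)) * cexp (-(I * (θ y : ℂ))) := by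
  rw [← Complex.normSq_eq_norm_sq, ← Complex.mul_conj, map_sum, Finset.sum_mul_sum]
  refine Finset.sum_congr rfl fun x _ => Finset.sum_congr rfl fun y _ => ?_
  congr 1
  rw [← Complex.exp_conj, map_mul, Complex.conj_I, Complex.conj_ofReal, neg_mul]

/-- volume of the cube `[0,2π]^Λ` as a complex integral of `1`. [folklore] -/
theorem integral_cube_one {Λ' : Type*} [Fintype Λ'] :
    ∫ _θ in Set.pi Set.univ (fun _ : Λ' => Icc (0:ℝ) (2 * Real.pi)), (1 : ℂ) =
      (((2 * Real.pi) ^ Fintype.card Λ' : ℝ) : ℂ) := by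
  rw [setIntegral_const, Measure.real_def, volume_pi_pi]
  simp only [Real.volume_Icc, sub_zero, Finset.prod_const, Finset.card_univ]
  rw [ENNReal.toReal_pow, ENNReal.toReal_ofReal (by positivity), Complex.real_smul, mul_one]

/-- integrability on the cube of the elementary oscillating products. [folklore] -/
theorem integrable_cube_cexp_mul_cexp_neg {Λ' : Type*} [Fintype Λ'] (a b : Λ') :
    Integrable (fun θ : Λ' → ℝ => cexp (I * (θ a : ℂ)) * cexp (-(I * (θ b : ℂ))))
      (volume.restrict (Set.pi Set.univ (fun _ : Λ' => Icc (0:ℝ) (2 * Real.pi)))) := by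
  have hc : Continuous (fun θ : Λ' → ℝ => cexp (I * (θ a : ℂ)) * cexp (-(I * (θ b : ℂ)))) := by
    fun_prop
  exact hc.continuousOn.integrableOn_compact (isCompact_univ_pi fun _ => isCompact_Icc)

/-- THE ZERO-COUPLING SLICE INTEGRAL: for an injective slice map `e : σ → Λ`,
`∫_{[0,2π]^Λ} |Σ_{x∈σ} e^{iθ(e x)}|² / D dθ = |σ|·(2π)^{|Λ|} / D`. [folklore] -/
theorem integral_cube_normSq_slice {Λ' σ : Type*} [Fintype Λ'] [DecidableEq Λ'] [Fintype σ]
    [DecidableEq σ] (e : σ → Λ') (he : Function.Injective e) (D : ℝ) :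
    ∫ θ in Set.pi Set.univ (fun _ : Λ' => Icc (0:ℝ) (2 * Real.pi)),
      (((‖∑ x, cexp (I * (θ (e x) : ℂ))‖ ^ 2 / D : ℝ)) : ℂ) =
    ((Fintype.card σ : ℝ) * (2 * Real.pi) ^ Fintype.card Λ' / D : ℝ) := by
  have h1 : ∀ θ : Λ' → ℝ, (((‖∑ x, cexp (I * (θ (e x) : ℂ))‖ ^ 2 / D : ℝ)) : ℂ) =
      (∑ x, ∑ y, cexp (I * (θ (e x) : ℂ)) * cexp (-(I * (θ (e y) : ℂ)))) / (D : ℂ) := by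
    intro θ
    rw [Complex.ofReal_div, normSq_sum_cexp (fun x => θ (e x))]
  simp_rw [h1]
  rw [integral_div, integral_finsetSum _ (fun x _ => integrable_finsetSum _
        (fun y _ => integrable_cube_cexp_mul_cexp_neg (e x) (e y)))]
  simp_rw [integral_finsetSum _ (fun y _ => integrable_cube_cexp_mul_cexp_neg (e _) (e y)),
    integral_cube_cexp_mul_cexp_neg, he.eq_iff, Finset.sum_ite_eq, Finset.mem_univ, if_true,
    Finset.sum_const, Finset.card_univ, nsmul_eq_mul]
  push_cast; ring

/-- at zero coupling the slice order is `1/L² < 1/2` (`L ≥ 2`). [folklore] -/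
theorem sliceRatio_zero_lt_half (L M : ℕ) [NeZero L] [NeZero M] (hL : 2 ≤ L) :
    ((∫ θ in cube L M,
        (((‖∑ x : TorusSite 2 L, cexp (I * (θ (x, 0) : ℂ))‖ ^ 2 / (L : ℝ) ^ 4 : ℝ)) : ℂ)) /
      (∫ _θ in cube L M, (1 : ℂ))).re < 1 / 2 := by
  unfold cube
  rw [integral_cube_normSq_slice (fun x : TorusSite 2 L => ((x, (0 : ZMod M)) : Λ L M))
      (fun x y hxy => (Prod.mk.inj hxy).1) ((L : ℝ) ^ 4), integral_cube_one, ← Complex.ofReal_div,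
    Complex.ofReal_re]
  have hcard : (Fintype.card (TorusSite 2 L) : ℝ) = (L : ℝ) ^ 2 := by
    rw [Fintype.card_pi, Finset.prod_const, ZMod.card, Finset.card_univ, Fintype.card_fin]; push_cast; ring
  rw [hcard]
  have hL' : (2 : ℝ) ≤ L := by exact_mod_cast hL
  set Q : ℝ := (2 * Real.pi) ^ Fintype.card (Λ L M) with hQdef
  have hQ : (0 : ℝ) < Q := by positivity
  have hL2 : (4 : ℝ) ≤ (L : ℝ) ^ 2 := by nlinarith
  have hL2Q : (0 : ℝ) < (L : ℝ) ^ 2 * Q := by positivity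
  have h3 : (L : ℝ) ^ 2 * Q * 4 ≤ (L : ℝ) ^ 2 * Q * (L : ℝ) ^ 2 :=
    mul_le_mul_of_nonneg_left hL2 hL2Q.le
  rw [div_div, div_lt_iff₀ (by positivity)]
  calc (L : ℝ) ^ 2 * Q < (L : ℝ) ^ 2 * Q * 4 / 2 := by linarith
    _ ≤ (L : ℝ) ^ 2 * Q * (L : ℝ) ^ 2 / 2 := by linarith
    _ = 1 / 2 * ((L : ℝ) ^ 4 * Q) := by ring

/-- SMALL COUPLING IS DISORDERED AT FIXED VOLUME: for every continuous `S` and every `(L, M)` with `L ≥ 2`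
there is a coupling `0 < κ₁ ≤ 1` at which the slice order of the weight `e^{−κ S}` is `< 1/2`
(continuity at `κ = 0`). [folklore] -/
theorem exists_small_coupling (L M : ℕ) [NeZero L] [NeZero M] (hL : 2 ≤ L)
    {S : (Λ L M → ℝ) → ℂ} (hS : Continuous S) :
    ∃ κ₁ : ℝ, 0 < κ₁ ∧ κ₁ ≤ 1 ∧
      ((∫ θ in cube L M,
          (((‖∑ x : TorusSite 2 L, cexp (I * (θ (x, 0) : ℂ))‖ ^ 2 / (L : ℝ) ^ 4 : ℝ)) : ℂ) *
            cexp (-((κ₁ : ℂ) * S θ))) /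
        (∫ θ in cube L M, cexp (-((κ₁ : ℂ) * S θ)))).re < 1 / 2 := by
  set N : ℝ → ℂ := fun κ => ∫ θ in cube L M,
      (((‖∑ x : TorusSite 2 L, cexp (I * (θ (x, 0) : ℂ))‖ ^ 2 / (L : ℝ) ^ 4 : ℝ)) : ℂ) *
        cexp (-((κ : ℂ) * S θ)) with hN
  set Z : ℝ → ℂ := fun κ => ∫ θ in cube L M, cexp (-((κ : ℂ) * S θ)) with hZ
  have hNc : Continuous N :=
    continuous_couplingIntegral L M hS (g := fun θ : Λ L M → ℝ =>
      (((‖∑ x : TorusSite 2 L, cexp (I * (θ (x, 0) : ℂ))‖ ^ 2 / (L : ℝ) ^ 4 : ℝ)) : ℂ)) (by fun_prop)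
  have hZc : Continuous Z := by
    have := continuous_couplingIntegral L M hS (g := fun _ : Λ L M → ℝ => (1 : ℂ)) continuous_const
    simpa only [one_mul] using this
  have hZ0' : Z 0 = (((2 * Real.pi) ^ Fintype.card (Λ L M) : ℝ) : ℂ) := by
    simp only [hZ, Complex.ofReal_zero, zero_mul, neg_zero, Complex.exp_zero]
    exact integral_cube_one
  have hZ0 : Z 0 ≠ 0 := by
    rw [hZ0']
    exact_mod_cast (by positivity : (0:ℝ) < (2 * Real.pi) ^ Fintype.card (Λ L M)).ne'
  have h0 : ((N 0) / (Z 0)).re < 1 / 2 := by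
    simp only [hN, hZ, Complex.ofReal_zero, zero_mul, neg_zero, Complex.exp_zero, mul_one]
    exact sliceRatio_zero_lt_half L M hL
  have hcont : ContinuousAt (fun κ : ℝ => ((N κ) / (Z κ)).re) 0 :=
    Complex.continuous_re.continuousAt.comp ((hNc.continuousAt).div (hZc.continuousAt) hZ0)
  obtain ⟨ε, hε, h⟩ := Metric.eventually_nhds_iff.1 (hcont.eventually (gt_mem_nhds h0))
  refine ⟨min (ε / 2) 1, by positivity, min_le_right _ _, ?_⟩
  have hd : dist (min (ε / 2) 1) 0 < ε := by
    rw [Real.dist_eq, sub_zero, abs_of_pos (by positivity)]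
    exact lt_of_le_of_lt (min_le_left _ _) (by linarith)
  exact h hd

/-! ### §3 The strengthened engine is false -/

/-- **The threshold of the restated engine cannot be uniform in the coercivity constant.**  The negated
statement is `Theses.BalabanIR.BirComplexStableXYR` verbatim with `∃ K₀ L₀` moved in front of `∀ c₀ > 0`.
Refutation by the all-pairs real XY window table at `r = 2`, `B = 64(1+e²)`: given the putative `K₀, L₀`, the
table `xyPair[2, κ₁/K]` with `K = max K₀ 1`, `c₀ = κ₁/K`, is admissible and satisfies (R), (P), but at
`L = M = 2L₀+2` its slice order is that of the XY weight at coupling `κ₁`, which is `< 1/2` for the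
`κ₁ ∈ (0,1]` of `exists_small_coupling`. -/
theorem not_birComplexStableXYR_uniformThreshold : ¬ (
  ∀ (r : ℕ) (B : ℝ), 2 ≤ r → ∃ K₀ : ℝ, ∃ L₀ : ℕ, ∀ c₀ : ℝ, 0 < c₀ → ∀ K : ℝ, K₀ ≤ K → ∀ c : ((Fin r × Fin r × Fin r) → ℤ) →₀ ℂ, (∀ n ∈ c.support, ∑ w, n w = 0) → c.sum (fun _ a => a) = 0 → c.sum (fun n a => ‖a‖ * Real.exp (∑ w, |(n w : ℝ)|)) ≤ B → (∀ φ : (Fin r × Fin r × Fin r) → ℝ, c₀ * ∑ w, ∑ w', (1 - Real.cos (φ w - φ w')) ≤ ((fun (φ : (Fin r × Fin r × Fin r) → ℝ) => c.sum (fun n a => a * Complex.exp (Complex.I * ((∑ w, (n w : ℝ) * φ w : ℝ) : ℂ)))) φ).re) → (∀ n : (Fin r × Fin r × Fin r) → ℤ, c (fun w => n (w.1, w.2.1, Fin.rev w.2.2)) = (starRingEnd ℂ) (c (-n))) → (∀ n : (Fin r × Fin r × Fin r) → ℤ, c (fun w => n (Fin.rev w.1, Fin.rev w.2.1, w.2.2))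 = c n) → ∀ (L M : ℕ) [NeZero L] [NeZero M], L₀ ≤ L → L ≤ M → Even L → Even M → let sh : (Literature.Probability.LatticeModels.TorusSite 2 L × ZMod M) → (Fin r × Fin r × Fin r) → (Literature.Probability.LatticeModels.TorusSite 2 L × ZMod M) := fun s w => (s.1 + ![((w.1 : ℕ) : ZMod L), ((w.2.1 : ℕ) : ZMod L)], s.2 + ((w.2.2 : ℕ) : ZMod M)); let F : ((Fin r × Fin r × Fin r) → ℝ) → ℂ := fun (φ : (Fin r × Fin r × Fin r) → ℝ) => c.sum (fun n a => a * Complex.exp (Complex.I * ((∑ w, (n w : ℝ) * φ w : ℝ) : ℂ))); let A : ((Literature.Probability.LatticeModels.TorusSite 2 L × ZMod M) → ℝ) → ℂ := fun θ => (K : ℂ) * ∑ s : (Literature.Probability.LatticeModels.TorusSite 2 L × ZMod M), F (fun w => θ (sh s w)); let cube : Set ((Literature.Probability.LatticeModels.TorusSite 2 L × ZMod M) → ℝ) := Set.pi Set.univ (fun _ => Set.Icc (0:ℝ) (2 * Real.pi)); let Z : ℂ := MeasureTheory.integral (MeasureTheory.volume.restrict cube) (fun θ => Complex.exp (-(A θ)));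 let O : ((Literature.Probability.LatticeModels.TorusSite 2 L × ZMod M) → ℝ) → ℝ := fun θ => ‖∑ x : Literature.Probability.LatticeModels.TorusSite 2 L, Complex.exp (Complex.I * (θ (x, 0) : ℂ))‖ ^ 2 / (L : ℝ) ^ 4; Z ≠ 0 ∧ (1/2 : ℝ) ≤ ((MeasureTheory.integral (MeasureTheory.volume.restrict cube) (fun θ => (O θ : ℂ) * Complex.exp (-(A θ)))) / Z).re ) := by
  intro h
  -- work at a variable side `r = 2`: unifying the expanded table at a numeral side is needlessly deep
  obtain ⟨r, hr⟩ : ∃ r : ℕ, r = 2 := ⟨2, rfl⟩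
  have hcard : (Fintype.card (W r × W r) : ℝ) = 64 := by
    subst hr; simp only [Fintype.card_prod, Fintype.card_fin]; norm_num
  obtain ⟨K₀, L₀, h⟩ := h r (64 * (1 + Real.exp 2)) hr.ge
  set L : ℕ := 2 * L₀ + 2 with hLdef
  haveI : NeZero L := ⟨by omega⟩
  have hL₀ : L₀ ≤ L := by omega
  have h2 : 2 ≤ L := by omega
  have hLe : Even L := ⟨L₀ + 1, by omega⟩
  have hS : Continuous (fun θ : Λ L L → ℝ => ∑ s : Λ L L, ∑ p : W r × W r,
      (1 - cexp (I * ((θ (sh L L s p.1) - θ (sh L L s p.2) : ℝ) : ℂ)))) := by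
    fun_prop
  obtain ⟨κ₁, hκ₁, hκ₁1, hlt⟩ := exists_small_coupling L L h2 hS
  set K : ℝ := max K₀ 1 with hKdef
  have hK1 : 1 ≤ K := le_max_right _ _
  have hK0 : 0 < K := by linarith
  set a : ℝ := κ₁ / K with hadef
  have ha : 0 < a := by positivity
  have ha1 : a ≤ 1 := by
    rw [hadef, div_le_one hK0]; linarith
  have hKa : K * a = κ₁ := by rw [hadef]; field_simp
  have hA : normA ((∑ p : W r × W r, ((a : ℝ) : ℂ) • (Finsupp.single (0 : Freq r) (1 : ℂ) -
      Finsupp.single (Pi.single (Prod.fst p) (1 : ℤ) - Pi.single (Prod.snd p) (1 : ℤ)) (1 : ℂ)) : Table r)) ≤ 64 * (1 + Real.exp 2) := by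
    refine (xyPair_A (r := r) a ha.le).trans ?_
    rw [hcard]
    have : 0 < 1 + Real.exp 2 := by positivity
    nlinarith
  -- name every component before the application (see `…XYPairTable`, `engineR_hypotheses_satisfiable`)
  have hU1 := xyPair_U1 (r := r) a
  have hN := xyPair_N (r := r) a
  have hC : ∀ φ : W r → ℝ, a * ∑ w, ∑ w', (1 - Real.cos (φ w - φ w')) ≤ (genF ((∑ p : W r × W r, ((a : ℝ) : ℂ) • (Finsupp.single (0 : Freq r) (1 : ℂ) -
      Finsupp.single (Pi.single (Prod.fst p) (1 : ℤ) - Pi.single (Prod.snd p) (1 : ℤ)) (1 : ℂ)) : Table r)) φ).re :=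
    fun φ => le_of_eq (xyPair_C a φ)
  have hR := xyPair_R (r := r) a
  have hP := xyPair_P (r := r) a
  have key := h a ha K (le_max_left _ _) _ hU1 hN hA hC hR hP L L hL₀ le_rfl hLe hLe
  dsimp only at key
  -- our side, in the named form, then unfolded to the crux's verbatim form
  have hmine : ¬ ((1/2 : ℝ) ≤ ((∫ θ in cube L L,
      (((‖∑ x : TorusSite 2 L, cexp (I * (θ (x, 0) : ℂ))‖ ^ 2 / (L : ℝ) ^ 4 : ℝ)) : ℂ) *
        cexp (-(action K ((∑ p : W r × W r, ((a : ℝ) : ℂ) • (Finsupp.single (0 : Freq r) (1 : ℂ) -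
      Finsupp.single (Pi.single (Prod.fst p) (1 : ℤ) - Pi.single (Prod.snd p) (1 : ℤ)) (1 : ℂ)) : Table r)) L L θ))) / partZ K ((∑ p : W r × W r, ((a : ℝ) : ℂ) • (Finsupp.single (0 : Freq r) (1 : ℂ) -
      Finsupp.single (Pi.single (Prod.fst p) (1 : ℤ) - Pi.single (Prod.snd p) (1 : ℤ)) (1 : ℂ)) : Table r)) L L).re) := by
    simp only [partZ, action_xyPair, hKa]
    exact not_le.mpr hlt
  dsimp only [partZ, action, genF, sh, cube] at hmine
  exact hmine key.2

end Summit.HubbardSuperconductivity.HubbardSuperconductivity.Theorems.BirGappedPhaseReductionR.Negative
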